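import Mathlib
import Summits.Ventures.HodgeRepro.BallGenBoost

/-!
# The isotropy of the centre and the unitary orbit of a covector

Blind re-derivation cell `pub-hodge-repro`, seat `typer-2` (gen 3).  For a unitary `A ∈ U(p)` the block matrix
`diag(A, 1)` lies in `U(p,1)` (`rot A hA`), fixes the centre, and its Jacobian at the centre is `A` itself; by the chain
rule `J_{g·rot A}(0) = J_g(0) · A` — the isotropy representation of the centre on covectors is the natural `U(p)`-action.
The ORBIT LEMMA `exists_unitary_transpose_mulVec_not_mem`: for a non-zero covector `u` and a proper subspace `V ⊊ ℂ^p`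
some unitary `A` has `Aᵀ u ∉ V` — proved with the swap matrices `Matrix.swap` and the sign flips `flipMat k` only
(their orbit of `u` spans `ℂ^p`).  This is the "`U(p)`-irreducibility" clause of ROUTE.md Appendix A4 (Lemma W).
-/

set_option autoImplicit false

noncomputable section

namespace HodgeRepro.BallGen

open Matrix

variable {p : ℕ}

/-! ### Rotations `diag(A, 1)` -/

/-- The block matrix `diag(A, 1)`. -/
def rotMat (A : Matrix (Fin p) (Fin p) ℂ) : Matrix (Idx p) (Idx p) ℂ := fromBlocks A 0 0 1

/-- For `A` unitary, `diag(A, 1)` preserves `J`. -/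
theorem rotMat_rel {A : Matrix (Fin p) (Fin p) ℂ} (hA : Aᴴ * A = 1) :
    (rotMat A)ᴴ * J p * rotMat A = J p := by
  rw [rotMat, J_eq_fromBlocks, fromBlocks_conjTranspose, fromBlocks_multiply, fromBlocks_multiply]
  simp [hA]

/-- The rotation `diag(A, 1) ∈ U(p,1)` of a unitary `A`. -/
def rot (A : Matrix (Fin p) (Fin p) ℂ) (hA : Aᴴ * A = 1) : U p := mkU (rotMat A) (rotMat_rel hA)

/-- The matrix of a rotation. -/
@[simp] theorem mat_rot (A : Matrix (Fin p) (Fin p) ℂ) (hA : Aᴴ * A = 1) : mat (rot A hA) = rotMat A := rfl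

/-- A rotation fixes the lift of the centre. -/
theorem W_rot_center (A : Matrix (Fin p) (Fin p) ℂ) (hA : Aᴴ * A = 1) :
    W (rot A hA) (center p) = lift (center p) := by
  unfold W
  rw [mat_rot, rotMat, lift_center, fromBlocks_mulVec]
  ext i
  rcases i with i | i <;> simp

/-- A rotation fixes the centre. -/
theorem act_rot_center (A : Matrix (Fin p) (Fin p) ℂ) (hA : Aᴴ * A = 1) :
    act (rot A hA) (center p) = center p := by
  calc act (rot A hA) (center p) = proj (W (rot A hA) (center p)) (Q_W _ _) := rfl
    _ = proj (lift (center p)) (Q_lift _) := proj_congr (W_rot_center A hA) _ _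
    _ = center p := by
        apply Subtype.ext
        ext i
        simp [proj, lift, center]

/-- The Jacobian of a rotation at the centre is `A`. -/
theorem Jac_rot_center (A : Matrix (Fin p) (Fin p) ℂ) (hA : Aᴴ * A = 1) :
    Jac (rot A hA) (center p) = A := by
  ext i j
  unfold Jac
  rw [Matrix.of_apply, W_rot_center]
  simp [mat_rot, rotMat, lift, center]

/-- `J_{g · rot A}(0) = J_g(0) · A` (chain rule at the fixed centre). -/
theorem Jac_mul_rot_center (g : U p) (A : Matrix (Fin p) (Fin p) ℂ) (hA : Aᴴ * A = 1) :
    Jac (g * rot A hA) (center p) = Jac g (center p) * A := by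
  rw [Jac_mul, act_rot_center, Jac_rot_center]

/-- `(g · rot A) 0 = g 0`. -/
theorem act_mul_rot_center (g : U p) (A : Matrix (Fin p) (Fin p) ℂ) (hA : Aᴴ * A = 1) :
    act (g * rot A hA) (center p) = act g (center p) := by
  rw [← act_mul, act_rot_center]

/-! ### Unitary matrices: swaps, sign flips, products -/

/-- The swap matrix is unitary. -/
theorem swap_unitary (j k : Fin p) : (swap ℂ j k)ᴴ * swap ℂ j k = 1 := by
  rw [conjTranspose_swap, swap_mul_self]

/-- The sign flip at `k`: `diag(1, …, −1, …, 1)`. -/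
def flipMat (k : Fin p) : Matrix (Fin p) (Fin p) ℂ := diagonal fun i => if i = k then -1 else 1

/-- The sign flip is unitary. -/
theorem flipMat_unitary (k : Fin p) : (flipMat k)ᴴ * flipMat k = 1 := by
  rw [flipMat, diagonal_conjTranspose, diagonal_mul_diagonal]
  ext i j
  by_cases h : i = j
  · subst h
    by_cases hk : i = k <;> simp [hk]
  · simp [h]

/-- The sign flip is symmetric. -/
theorem flipMat_transpose (k : Fin p) : (flipMat k)ᵀ = flipMat k := diagonal_transpose _

/-- `flipMat k *ᵥ v` negates the `k`-th coordinate. -/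
theorem flipMat_mulVec (k : Fin p) (v : Fin p → ℂ) (i : Fin p) :
    (flipMat k *ᵥ v) i = if i = k then -v i else v i := by
  simp [flipMat, mulVec_diagonal]

/-- A product of unitary matrices is unitary. -/
theorem mul_unitary {A B : Matrix (Fin p) (Fin p) ℂ} (hA : Aᴴ * A = 1) (hB : Bᴴ * B = 1) :
    (A * B)ᴴ * (A * B) = 1 := by
  rw [conjTranspose_mul, Matrix.mul_assoc, ← Matrix.mul_assoc Aᴴ, hA, Matrix.one_mul, hB]

/-! ### The orbit lemma -/

/-- **Orbit lemma.**  For a non-zero covector `u ∈ ℂ^p` and a proper subspace `V ≠ ⊤`, some unitary `A`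
(a swap times a sign flip) has `Aᵀ u ∉ V`: the `U(p)`-orbit of `u` is not contained in any proper subspace. -/
theorem exists_unitary_transpose_mulVec_not_mem {u : Fin p → ℂ} (hu : u ≠ 0) (V : Submodule ℂ (Fin p → ℂ))
    (hV : V ≠ ⊤) : ∃ A : Matrix (Fin p) (Fin p) ℂ, Aᴴ * A = 1 ∧ Aᵀ *ᵥ u ∉ V := by
  by_contra h
  push Not at h
  apply hV
  rw [eq_top_iff]
  obtain ⟨j, hj⟩ : ∃ j, u j ≠ 0 := by
    by_contra h'
    push Not at h'
    exact hu (funext h')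
  have hk : ∀ k : Fin p, (fun l => if k = l then (1 : ℂ) else 0) ∈ V := by
    intro k
    have h1 := h (swap ℂ j k) (swap_unitary j k)
    have h2 := h (swap ℂ j k * flipMat k) (mul_unitary (swap_unitary j k) (flipMat_unitary k))
    rw [transpose_swap, swap_mulVec] at h1
    rw [transpose_mul, flipMat_transpose, transpose_swap, ← mulVec_mulVec, swap_mulVec] at h2
    have h3 := V.sub_mem h1 h2
    have e : (u ∘ Equiv.swap j k) - flipMat k *ᵥ (u ∘ Equiv.swap j k) =
        (2 * u j) • fun l => if k = l then (1 : ℂ) else 0 := by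
      ext i
      simp only [Pi.sub_apply, Function.comp_apply, flipMat_mulVec, Pi.smul_apply, smul_eq_mul]
      by_cases hik : i = k
      · subst hik; simp [Equiv.swap_apply_right]; ring
      · simp [hik, Ne.symm hik]
    rw [e] at h3
    exact (V.smul_mem_iff (by simpa using hj)).1 h3
  intro x _
  rw [pi_eq_sum_univ x]
  exact V.sum_mem fun k _ => V.smul_mem _ (hk k)

end HodgeRepro.BallGen

end
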